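import Summits.ResolutionOfSingularities.ResolutionOfSingularities.Theorems.MarkedTransferCampaignW36SupplyTBHolds
import Literature.AlgebraicGeometry.Hironaka2017.Proofs.S06BaseHike.U30L4fSymbolicFG
import Literature.RingTheory.GradedAlgebra.VeroneseOfFiltrationConverse
import HarnessLib

/-!
# [L1 W3.6 · reach of the door] The Veronese shape of T-B/T-AB forces FINITELY GENERATED differential-power stalk towers;
# on the class 𝒞 every stalk tower `n ↦ (𝓘_C^{⟨n⟩})_x` is finitely generated

Cell `res-hironaka`, rung L, slot W3.6 lineage (seat res-L1-s36-pv-1, g1), GAP-LEDGER R12/12a residual ⟨StableTower⟩ OFF the class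
`𝒞 = LCIOrMonomialClass`. HOST item stmt-ResolutionOfSingularities-16155 via `--supports`. HONEST FRAMING (D-0012/D-0089): kernel
theorems about OUR typed carriers (res-type-010's `S06BaseHike.diffPower`, o4's door shapes of p488503, this seat's T-B/T-AB p494780);
nothing printed in [Hironaka2017] is asserted and the manuscript stays «under review». AI-produced; weaker than expert review.

WHAT THIS FILE ADDS. The W3.6 door (p494780 `campaignW36CoreFocusExists_lciOrMonomial_holds`) reaches the (43)-object `Ě` through ONE
algebraic shape, the binder of res-type-010's `stableAt_of_veronese`: «`𝓘_C^{⟨k b₀⟩} ≤ (𝓘_C^{⟨b₀⟩})^k` for all `k`, some `b₀ > 0`»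
(`CampaignW36.VeroneseOfLCIOrMonomialCutOn`). By the tree's Herzog–Hibi–Trung 2007 Thm 2.1 (b) ⇒ (a) for decreasing filtrations
(`Literature.RingTheory.GradedAlgebra.exists_weightedMonomial_generators_of_veronese_le_pow`, p522279) that shape FORCES, at every
point `x`, the stalk tower `n ↦ (𝓘_C^{⟨n⟩})_x` to be finitely generated by weighted elements (the symbolic-Rees-type algebra
`⊕_n (𝓘_C^{⟨n⟩})_x tⁿ` is a finitely generated `𝒪_{Z,x}`-algebra, in the def-free vocabulary of `VeroneseOfFiltration.lean`):
* `diffPower_antitone`, `stalkIdeal_diffPower_zero/_mul_le/_antitone` (with res-type-010's `S06BaseHike.diffPower_zero`, p-file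
  `U30L4fSymbolicFG`) — the stalk tower is a decreasing multiplicative filtration with `J 0 = ⊤` (any scheme);
* **`exists_stalkTower_generators_of_veronese`** — the REACH theorem (locally Noetherian `Z`): the door's Veronese shape at `C` ⇒ every
  stalk tower of `C` is finitely generated; **`not_veronese_of_not_stalkTower_generators`** — contrapositive: a cut with ONE non-finitely-
  generated differential-power stalk tower admits NO Veronese level `b₀`, i.e. lies outside the reach of the W3.6 route (this is where
  the non-Noetherian symbolic Rees algebras of the literature — Sannai–Tanaka 2019 Thm 3.7, Kurano et al. 2025 Ex. 1.4 (2), positive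
  characteristic — would enter; none is formalised here);
* **`exists_stalkTower_generators_lciOrMonomial`** — ON 𝒞, UNCONDITIONALLY: for every ambient datum and every closed `C ⊆ A.Z` that is
  an l.c.i. cut or a monomial cut at each of its points, every stalk tower `n ↦ (𝓘_C^{⟨n⟩})_x` is finitely generated (T-AB p494780 ∘ reach).
What this does NOT say: the 𝔖-level residual ⟨StableTower⟩ (`CampaignW31.HatStableTowerPos`) off 𝒞 is untouched — turning a
non-finitely-generated tower into `¬ StableAt` needs the 𝔖-to-valuation fact (F-20b) and an integral-closure step, both named elsewhere
(ledger/evidence/R12/res-type-009-ObstructionCandidate-SannaiTanaka.md §6); this file bounds the METHOD, not the residual.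
-/

noncomputable section

set_option linter.dupNamespace false -- mandated namespace of this single-conjunct summit

open _root_.AlgebraicGeometry _root_.TopologicalSpace _root_.CategoryTheory _root_.IsLocalRing

namespace Summit.ResolutionOfSingularities.ResolutionOfSingularities.Theorems

open Literature.AlgebraicGeometry.Resolution
open Literature.AlgebraicGeometry.Hironaka2017
open Literature.AlgebraicGeometry.Hironaka2017.S02Preliminaries
open Literature.AlgebraicGeometry.Hironaka2017.S04CharAlgebra
open Literature.AlgebraicGeometry.Hironaka2017.S06BaseHike
open Literature.AlgebraicGeometry.Hironaka2017.Datum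
open Literature.RingTheory.GradedAlgebra
open Scheme.IdealSheafData

universe u

namespace CampaignW36

/-! ## The differential-power stalk tower is a decreasing multiplicative filtration with `J 0 = ⊤` -/

section AnyScheme

variable {Z : Scheme.{u}}

/-- The differential powers DECREASE: `a ≤ b ⇒ 𝓘_C^{⟨b⟩} ≤ 𝓘_C^{⟨a⟩}`. OURS carrier bookkeeping. [folklore] -/
theorem diffPower_antitone (C : Closeds Z) : Antitone (diffPower C) := fun a b hab =>
  le_diffPower fun x hx => le_trans (by exact_mod_cast hab) (le_idealOrder_diffPower C b hx)

/-- `(𝓘_C^{⟨0⟩})_x = ⊤` (res-type-010's `S06BaseHike.diffPower_zero`, stalkwise). OURS carrier bookkeeping. [folklore] -/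
theorem stalkIdeal_diffPower_zero (C : Closeds Z) (x : Z) : stalkIdeal (diffPower C 0) x = ⊤ := by
  rw [S06BaseHike.diffPower_zero, stalkIdeal_top]

/-- `(𝓘_C^{⟨a⟩})_x · (𝓘_C^{⟨b⟩})_x ≤ (𝓘_C^{⟨a+b⟩})_x` (res-type-010's `diffPower_mul_le`, stalkwise). OURS carrier bookkeeping. [folklore] -/
theorem stalkIdeal_diffPower_mul_le (C : Closeds Z) (x : Z) (a b : ℕ) :
    stalkIdeal (diffPower C a) x * stalkIdeal (diffPower C b) x ≤ stalkIdeal (diffPower C (a + b)) x := by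
  rw [← stalkIdeal_mul]
  exact stalkIdeal_mono (diffPower_mul_le C a b) x

/-- The stalk tower `n ↦ (𝓘_C^{⟨n⟩})_x` decreases. OURS carrier bookkeeping. [folklore] -/
theorem stalkIdeal_diffPower_antitone (C : Closeds Z) (x : Z) : Antitone fun n => stalkIdeal (diffPower C n) x :=
  fun _ _ hab => stalkIdeal_mono (diffPower_antitone C hab) x

/-! ## The reach theorem -/

/-- **[OURS · L1 W3.6] REACH OF THE DOOR.** On a locally Noetherian scheme, if the closed set `C` satisfies the Veronese shape of the W3.6
door — `𝓘_C^{⟨k b₀⟩} ≤ (𝓘_C^{⟨b₀⟩})^k` for all `k`, some `b₀ > 0` (the binder `hver` of `S06BaseHike.stableAt_of_veronese`, the conclusion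
of `VeroneseOfMonomialCutOn` / `VeroneseOfLCIOrMonomialCutOn`) — then at EVERY point `x` the stalk tower `n ↦ (𝓘_C^{⟨n⟩})_x` is finitely
generated by weighted elements: there are `u_i ∈ (𝓘_C^{⟨d_i⟩})_x`, `d_i > 0`, with `(𝓘_C^{⟨N⟩})_x ≤ span{∏ u_i^{α_i} : Σ α_i d_i = N}` for
all `N` (Herzog–Hibi–Trung 2007 Thm 2.1 (b) ⇒ (a) in the tree's decreasing-filtration form, p522279, applied to the Noetherian stalk).
NOT a statement of the manuscript. [cite: HerzogHibiTrung2007, Thm 2.1 (b) ⇒ (a)] -/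
theorem exists_stalkTower_generators_of_veronese [IsLocallyNoetherian Z] (C : Closeds Z) {b₀ : ℕ} (hb₀ : 0 < b₀)
    (hver : ∀ k : ℕ, diffPower C (k * b₀) ≤ diffPower C b₀ ^ k) (x : Z) :
    ∃ (m : ℕ) (u : Fin m → Z.presheaf.stalk x) (d : Fin m → ℕ), (∀ i, 0 < d i) ∧
      (∀ i, u i ∈ stalkIdeal (diffPower C (d i)) x) ∧
      ∀ N, stalkIdeal (diffPower C N) x ≤
        Ideal.span {y | ∃ α : Fin m → ℕ, ∑ i, α i * d i = N ∧ y = ∏ i, u i ^ α i} :=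
  exists_weightedMonomial_generators_of_veronese_le_pow (J := fun n => stalkIdeal (diffPower C n) x)
    (stalkIdeal_diffPower_zero C x) (stalkIdeal_diffPower_mul_le C x) (stalkIdeal_diffPower_antitone C x) hb₀
    fun k => by
      rw [← stalkIdeal_pow]
      exact stalkIdeal_mono (hver k) x

/-- **[OURS · L1 W3.6] OUTSIDE THE REACH.** Contrapositive: if at some point `x` the stalk tower `n ↦ (𝓘_C^{⟨n⟩})_x` admits NO finite system
of weighted generators (e.g. its Rees-type algebra is not Noetherian), then `C` has NO Veronese level — `¬ ∃ b₀ > 0, ∀ k, 𝓘_C^{⟨k b₀⟩} ≤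
(𝓘_C^{⟨b₀⟩})^k` — so the W3.6 route (ord-pow / Veronese door) cannot produce `Ě` along such a cut. This bounds the METHOD only: the 𝔖-level
residual ⟨StableTower⟩ is not decided here. NOT a statement of the manuscript. [cite: HerzogHibiTrung2007, Thm 2.1 (b) ⇒ (a)] -/
theorem not_veronese_of_not_stalkTower_generators [IsLocallyNoetherian Z] (C : Closeds Z) (x : Z)
    (hx : ¬ ∃ (m : ℕ) (u : Fin m → Z.presheaf.stalk x) (d : Fin m → ℕ), (∀ i, 0 < d i) ∧
      (∀ i, u i ∈ stalkIdeal (diffPower C (d i)) x) ∧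
      ∀ N, stalkIdeal (diffPower C N) x ≤
        Ideal.span {y | ∃ α : Fin m → ℕ, ∑ i, α i * d i = N ∧ y = ∏ i, u i ^ α i}) :
    ¬ ∃ b₀ : ℕ, 0 < b₀ ∧ ∀ k : ℕ, diffPower C (k * b₀) ≤ diffPower C b₀ ^ k :=
  fun ⟨_, hb₀, hver⟩ => hx (exists_stalkTower_generators_of_veronese C hb₀ hver x)

end AnyScheme

/-! ## On the class 𝒞: every differential-power stalk tower is finitely generated (T-AB ∘ reach) -/

section Ambient

variable {p : ℕ} [Fact p.Prime] {K : Type u} [Field K] [CharP K p]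

/-- The ambient scheme of a row-001 `AmbientDatum` is locally Noetherian. [folklore] -/
private theorem ambient_isLocallyNoetherian'' (A : AmbientDatum p K) : IsLocallyNoetherian A.Z :=
  -- adapted from Summits/…/Theorems/MarkedTransferCampaignW36SupplyLemmas.lean (private `ambient_isLocallyNoetherian`)
  haveI := A.smooth
  haveI := A.quasiCompact
  haveI := Scheme.isNoetherian_of_finiteType_over_field A.hom
  inferInstance

/-- **[OURS · L1 W3.6] ON 𝒞 THE STALK TOWERS ARE FINITELY GENERATED, UNCONDITIONALLY.** For every ambient datum `A` (row 001) and every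
closed `C ⊆ A.Z` that is, at each of its points, a local-complete-intersection cut OR a monomial cut (`IsLCICutAt C x ∨ IsMonomialCutAt C x`,
the pointwise class of the W3.6 door), and every point `x` of `A.Z`: the stalk tower `n ↦ (𝓘_C^{⟨n⟩})_x` is finitely generated by
weighted elements — T-AB `veroneseOfLCIOrMonomialCutOn_holds` (p494780, uniform level) ∘ `exists_stalkTower_generators_of_veronese`.
NOT a statement of the manuscript. [cite: HerzogHibiTrung2007, Thm 2.1, Cor. 2.2] -/
theorem exists_stalkTower_generators_lciOrMonomial (A : AmbientDatum p K) (C : Closeds A.Z)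
    (hC : ∀ x ∈ (C : Set A.Z), IsLCICutAt C x ∨ IsMonomialCutAt C x) (x : A.Z) :
    ∃ (m : ℕ) (u : Fin m → A.Z.presheaf.stalk x) (d : Fin m → ℕ), (∀ i, 0 < d i) ∧
      (∀ i, u i ∈ stalkIdeal (diffPower C (d i)) x) ∧
      ∀ N, stalkIdeal (diffPower C N) x ≤
        Ideal.span {y | ∃ α : Fin m → ℕ, ∑ i, α i * d i = N ∧ y = ∏ i, u i ^ α i} := by
  haveI := ambient_isLocallyNoetherian'' A
  obtain ⟨b₀, hb₀, hver⟩ := veroneseOfLCIOrMonomialCutOn_holds A C hC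
  exact exists_stalkTower_generators_of_veronese C hb₀ hver x

/-- The B-type slice: stalk towers of everywhere-MONOMIAL cuts are finitely generated (T-B `veroneseOfMonomialCutOn_holds` ∘ reach).
NOT a statement of the manuscript. [cite: HerzogHibiTrung2007, Thm 2.1, Cor. 2.2] -/
theorem exists_stalkTower_generators_monomial (A : AmbientDatum p K) (C : Closeds A.Z)
    (hC : ∀ x ∈ (C : Set A.Z), IsMonomialCutAt C x) (x : A.Z) :
    ∃ (m : ℕ) (u : Fin m → A.Z.presheaf.stalk x) (d : Fin m → ℕ), (∀ i, 0 < d i) ∧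
      (∀ i, u i ∈ stalkIdeal (diffPower C (d i)) x) ∧
      ∀ N, stalkIdeal (diffPower C N) x ≤
        Ideal.span {y | ∃ α : Fin m → ℕ, ∑ i, α i * d i = N ∧ y = ∏ i, u i ^ α i} := by
  haveI := ambient_isLocallyNoetherian'' A
  obtain ⟨b₀, hb₀, hver⟩ := veroneseOfMonomialCutOn_holds A C hC
  exact exists_stalkTower_generators_of_veronese C hb₀ hver x

end Ambient

end CampaignW36

end Summit.ResolutionOfSingularities.ResolutionOfSingularities.Theorems
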